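import Literature.NumberTheory.NumberFields.HilbertClassFieldOfCharacters
import HarnessLib

/-!
# The class field of a character of `Cl_K`, with its character and all its Frobenius elements
# (input of [Schoof2009, Lemma 16.2]: "H = Hilbert class field, prime ideals ↦ Frobenius")

The proof of [Schoof2009, Lemma 16.2] uses the Hilbert class field `H` of `K` through the
Artin isomorphism `Cl_K ≅ Gal(H/K)`, "prime ideals to their Frobenius".  The tree's proved global
class field theory provides the class fields character by character
(`Literature.NumberTheory.NumberFields.exists_unramified_splitPrimes_of_classGroupChar`: for
`ψ : Cl_K → ℂˣ` an everywhere unramified Galois `E_ψ ⊆ K̄` whose split primes have `ψ = 1`); here we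
record the sharper form needed for Chebotarëv arguments (Thaine's auxiliary primes,
[Schoof2009, Lemma 16.2]).  Topic `NumberTheory/NumberFields`; theorem-only file (no definition,
no named fact, D-0026):

* `Literature.NumberTheory.NumberFields.exists_classField_char_frobenius` — for every character `ψ` of `Cl(𝓞 K)` there are a finite
  abelian extension `E ⊆ K̄` of `K`, **unramified at every finite prime**, and an **injective**
  character `χ : Gal(E/K) ↪ ℂˣ` with **`χ(Frob_v) = ψ([v])` for every prime `v`** (every prime `Q`
  of `E` above `v`, every arithmetic Frobenius at `Q`).

Proof: exactly the construction of the tree's theorem (`E = L^{ker χ}` for the Galois avatar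
`ω_ψ = χ ∘ ψ_{L|K}` of the Hecke character of `ψ`), keeping track of the character.

## References

* R. Schoof, *Catalan's Conjecture*, Universitext, Springer 2009 [Schoof2009], proof of Lemma 16.2
  (p. 112: "the Artin isomorphism `Cl_K → Gal(H/K)` … prime ideals to their Frobenius").
* J. Neukirch, *Algebraic Number Theory*, Springer 1999 [NeukirchANT1999], VI (6.9), (7.1).
* D. A. Cox, *Primes of the form x² + ny²*, 2nd ed. 2013 [Cox2013], Thm. 8.10.
-/

noncomputable section

open NumberField IsDedekindDomain Filter Polynomial Field
open scoped IsMulCommutative nonZeroDivisors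

namespace Literature.NumberTheory.NumberFields

open Literature.NumberTheory.GaloisRepresentations Literature.NumberTheory.Automorphic
  Literature.NumberTheory.LFunctions

variable {K : Type} [Field K] [NumberField K]

/-- **The class field and the character cut out by a class-group character** (Artin reciprocity
for the Hilbert class field, character by character).  For `ψ : Cl(𝓞 K) → ℂˣ` there are a finite
Galois `E ⊆ K̄` over `K` with abelian group, unramified at every finite prime of `K`, and an
injective character `χ` of `Gal(E/K)` such that `χ(φ) = ψ([v])` for every prime `v` of `K`, every
prime `Q` of `E` above `v` and every arithmetic Frobenius `φ` at `Q`.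
[cite: Schoof2009, Lemma 16.2 (proof, p. 112)] [cite: NeukirchANT1999, Ch. VI §6 (6.9) and §7 (7.1)]
[cite: Cox2013, §8.A Thm. 8.10] -/
theorem exists_classField_char_frobenius (ψ : ClassGroup (𝓞 K) →* ℂˣ) :
    ∃ (E : IntermediateField K (AlgebraicClosure K)) (_ : FiniteDimensional K E) (_ : IsGalois K E)
      (χ : (E ≃ₐ[K] E) →* ℂˣ),
      (∀ a b : E ≃ₐ[K] E, Commute a b) ∧ Function.Injective χ ∧
      (∀ v : HeightOneSpectrum (𝓞 K), Algebra.IsUnramifiedIn (𝓞 E) v.asIdeal) ∧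
      ∀ (v : HeightOneSpectrum (𝓞 K)) (Q : Ideal (𝓞 E)), Q ∈ v.asIdeal.primesOver (𝓞 E) →
        ∀ φ : E ≃ₐ[K] E, IsArithFrobAt (𝓞 K) φ Q →
          χ φ = ψ (ClassGroup.mk0 ⟨v.asIdeal, asIdeal_mem_nonZeroDivisors v⟩) := by
  classical
  set hR := artinReciprocity_character_holds
  -- the Hecke character of `ψ`
  set ψ₀ : HeightOneSpectrum (𝓞 K) → ℂ :=
    fun v => (ψ (ClassGroup.mk0 ⟨v.asIdeal, asIdeal_mem_nonZeroDivisors v⟩) : ℂ) with hψ₀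
  have hray : IsRayClassCharacter (⊤ : Ideal (𝓞 K)) ψ₀ := isRayClassCharacter_top_of_classGroupHom ψ
  obtain ⟨ω, hωfin, hω⟩ := HeckeCharacter.exists_of_isRayClassCharacter (𝔣 := ⊤) top_ne_bot hray
  have hnot : ∀ v : HeightOneSpectrum (𝓞 K), ¬ (⊤ : Ideal (𝓞 K)) ≤ v.asIdeal :=
    fun v h => v.isPrime.ne_top (top_le_iff.mp h)
  -- it is Galois: `ω = χ ∘ ψ_{L|K}`
  obtain ⟨L, hLfd, hLab, χ, hωχ⟩ := HeckeCharacter.exists_eq_charHecke_of_isFiniteOrder ω hωfin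
  haveI := hLfd
  haveI := hLab
  haveI : NumberField L := NumberField.of_module_finite K L
  have hcomm : ∀ a b : L ≃ₐ[K] L, Commute a b := commute_of_isAbelianGalois L
  -- `E₀ = L^{ker χ}` and its copy `E ⊆ K̄`
  haveI : (χ.ker).Normal := Subgroup.normal_of_isMulCommutative _
  set E₀ : IntermediateField K L := IntermediateField.fixedField χ.ker with hE₀
  haveI : IsGalois K E₀ := IsGalois.of_fixedField_normal_subgroup χ.ker
  set E : IntermediateField K (AlgebraicClosure K) := IntermediateField.lift E₀ with hEdef
  have hEL : E ≤ L := IntermediateField.lift_le E₀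
  haveI : FiniteDimensional K E :=
    FiniteDimensional.of_injective (IntermediateField.inclusion hEL).toLinearMap
      (RingHom.injective (IntermediateField.inclusion hEL).toRingHom)
  set ι : E₀ ≃ₐ[K] E := IntermediateField.liftAlgEquiv E₀ with hι
  haveI : IsGalois K E := IsGalois.of_algEquiv ι
  haveI : NumberField E := NumberField.of_module_finite K E
  haveI : NumberField E₀ := NumberField.of_module_finite K E₀
  have hfixE₀ : E₀.fixingSubgroup = χ.ker := IntermediateField.fixingSubgroup_fixedField χ.ker
  -- the inflated character `ρ = χ ∘ r_L` is unramified everywhere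
  set ρ : FramedArtinRep K 1 := inflateCharacter L χ with hρdef
  obtain ⟨ω', -, hω'⟩ := artinReciprocity_character_primitive_holds (K := K) ρ
  have heq : ω' = ω := by
    apply HeckeCharacter.ext_of_eventually_valueAtUniformizer_eq
    have hunrL : ∀ᶠ v : HeightOneSpectrum (𝓞 K) in cofinite, Algebra.IsUnramifiedIn (𝓞 L) v.asIdeal :=
      Filter.eventually_cofinite.mpr (finite_setOf_not_isUnramifiedIn K L)
    filter_upwards [hunrL] with v hunr
    have hρv : ρ.IsUnramifiedAt v := inflateCharacter_isUnramifiedAt L χ hunr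
    obtain ⟨𝔓v, h𝔓v⟩ := v.primesAbove_nonempty
    obtain ⟨σ, hσ⟩ := HeightOneSpectrum.exists_isArithFrobAt_of_mem_primesAbove_holds h𝔓v
    rw [(hω' v).2 hρv 𝔓v h𝔓v σ hσ, hωχ, charHecke_valueAtUniformizer L χ hR hunr]
    haveI : 𝔓v.IsPrime := h𝔓v.1
    have hP := comap_ringOfIntegersToIntegralClosure_mem_primesOver_of_mem_primesAbove L h𝔓v
    have hrσ := isArithFrobAt_absRestrictNormalHom L hσ
    have hfrob : absRestrictNormalHom L σ = galFrob K L v := eq_galFrob hcomm hunr hP hrσ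
    rw [FramedRep.det_apply, Matrix.GeneralLinearGroup.val_det_apply, Matrix.det_fin_one, hρdef,
      inflateCharacter_apply_coe, hfrob]
  have hρunr : ∀ v : HeightOneSpectrum (𝓞 K), ρ.IsUnramifiedAt v := by
    intro v
    have h := (hω' v).1
    rw [heq] at h
    exact h.mp (hω v (hnot v)).1
  -- `E` is unramified everywhere
  have hunrE : ∀ v : HeightOneSpectrum (𝓞 K), Algebra.IsUnramifiedIn (𝓞 E) v.asIdeal := by
    intro v
    by_contra hram
    obtain ⟨𝔓, h𝔓, g, hg, hne⟩ := exists_mem_inertia_absRestrictNormalHom_ne_one (L := E) hram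
    apply hne
    have h1 : ρ g = 1 := hρunr v 𝔓 h𝔓 g hg
    have h2 : absRestrictNormalHom L g ∈ χ.ker := by
      rw [MonoidHom.mem_ker]
      rw [hρdef, inflateCharacter_apply] at h1
      exact (FramedRep.unitsContinuousMulEquivOfUnique (Fin 1) ℂ).injective (by rw [h1, map_one])
    rw [← hfixE₀, IntermediateField.mem_fixingSubgroup_iff] at h2
    rw [absRestrictNormalHom_eq_one_iff, IntermediateField.mem_fixingSubgroup_iff]
    intro x hx
    obtain ⟨y, hy, rfl⟩ := hx
    have hyE₀ : (y : L) ∈ E₀ := by simpa using hy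
    have h3 := h2 y hyE₀
    have hr : ((absRestrictNormalHom L g y : L) : AlgebraicClosure K) = g • (y : AlgebraicClosure K) :=
      AlgEquiv.restrictNormalHom_apply L _ y
    have h4 : ((absRestrictNormalHom L g y : L) : AlgebraicClosure K) = (y : AlgebraicClosure K) :=
      congrArg (fun z : L => (z : AlgebraicClosure K)) h3
    rw [hr] at h4
    exact h4
  -- the character `χ₀` of `Gal(E₀/K) ≅ Gal(L/K)/ker χ`, and its transport `χbar` to `Gal(E/K)`
  set res : (L ≃ₐ[K] L) →* (E₀ ≃ₐ[K] E₀) := AlgEquiv.restrictNormalHom E₀ with hres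
  have hres_surj : Function.Surjective res := AlgEquiv.restrictNormalHom_surjective L
  have hker : res.ker = χ.ker := by rw [hres, IntermediateField.restrictNormalHom_ker, hfixE₀]
  set eqv := QuotientGroup.quotientKerEquivOfSurjective res hres_surj with heqv
  set χ₀ : (E₀ ≃ₐ[K] E₀) →* ℂˣ :=
    (QuotientGroup.lift res.ker χ (by rw [hker])).comp eqv.symm.toMonoidHom with hχ₀def
  have hχ₀ : ∀ σ : L ≃ₐ[K] L, χ₀ (res σ) = χ σ := by
    intro σ
    rw [hχ₀def, MonoidHom.comp_apply]
    have : eqv.symm.toMonoidHom (res σ) = (QuotientGroup.mk σ : (L ≃ₐ[K] L) ⧸ res.ker) := by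
      apply eqv.injective
      rw [MulEquiv.toMonoidHom_eq_coe, MonoidHom.coe_coe, MulEquiv.apply_symm_apply]
      rfl
    rw [this, QuotientGroup.lift_mk]
  set χbar : (E ≃ₐ[K] E) →* ℂˣ := χ₀.comp (AlgEquiv.autCongr ι).symm.toMonoidHom with hχbar
  have hχbar : ∀ f : E ≃ₐ[K] E, χbar f = χ₀ ((AlgEquiv.autCongr ι).symm f) := fun f => rfl
  -- restriction compatibility: `σ|_E = ι ∘ (σ|_L)|_{E₀} ∘ ι⁻¹`
  have h4 : ∀ z : E₀, ((ι z : E) : AlgebraicClosure K) = ((z : L) : AlgebraicClosure K) :=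
    fun z => rfl
  have h5 : ∀ z : E, (((ι.symm z : E₀) : L) : AlgebraicClosure K) = (z : AlgebraicClosure K) := by
    intro z
    have := h4 (ι.symm z)
    rw [AlgEquiv.apply_symm_apply] at this
    exact this.symm
  have hinj : Function.Injective (fun z : E₀ => ((z : L) : AlgebraicClosure K)) :=
    fun a b h => Subtype.ext (Subtype.ext h)
  have hcompat : ∀ σ : absoluteGaloisGroup K,
      (AlgEquiv.autCongr ι).symm (absRestrictNormalHom E σ) = res (absRestrictNormalHom L σ) := by
    intro σ
    apply AlgEquiv.ext
    intro y
    apply hinj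
    have eL : ((((AlgEquiv.autCongr ι).symm (absRestrictNormalHom E σ) y : E₀) : L) :
        AlgebraicClosure K) = σ • ((y : L) : AlgebraicClosure K) := by
      have h3 : ((absRestrictNormalHom E σ (ι y) : E) : AlgebraicClosure K) =
          σ • ((ι y : E) : AlgebraicClosure K) := AlgEquiv.restrictNormalHom_apply E _ (ι y)
      rw [AlgEquiv.autCongr_symm, AlgEquiv.autCongr_apply, AlgEquiv.trans_apply,
        AlgEquiv.trans_apply, AlgEquiv.symm_symm, h5, h3, h4]
    have eR : (((res (absRestrictNormalHom L σ) y : E₀) : L) : AlgebraicClosure K) =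
        σ • ((y : L) : AlgebraicClosure K) := by
      have h1 : ((res (absRestrictNormalHom L σ) y : E₀) : L) = absRestrictNormalHom L σ (y : L) :=
        AlgEquiv.restrictNormal_commutes (absRestrictNormalHom L σ) E₀ y
      rw [h1]
      exact AlgEquiv.restrictNormalHom_apply L _ (y : L)
    exact eL.trans eR.symm
  -- `Gal(E/K)` is abelian
  have hsurjE : ∀ f : E ≃ₐ[K] E, ∃ σ : L ≃ₐ[K] L, f = AlgEquiv.autCongr ι (res σ) := by
    intro f
    obtain ⟨σ, hσ⟩ := hres_surj ((AlgEquiv.autCongr ι).symm f)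
    exact ⟨σ, by rw [hσ, MulEquiv.apply_symm_apply]⟩
  have hcommE : ∀ a b : E ≃ₐ[K] E, Commute a b := by
    intro a b
    obtain ⟨σ, rfl⟩ := hsurjE a
    obtain ⟨τ, rfl⟩ := hsurjE b
    exact ((hcomm σ τ).map res).map (AlgEquiv.autCongr ι).toMonoidHom
  refine ⟨E, inferInstance, inferInstance, χbar, hcommE, ?_, hunrE, ?_⟩
  · -- `χbar` is injective
    rw [injective_iff_map_eq_one]
    intro f hf
    obtain ⟨σ, rfl⟩ := hsurjE f
    rw [hχbar, MulEquiv.symm_apply_apply, hχ₀] at hf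
    have hσ : σ ∈ res.ker := by rw [hker]; exact hf
    rw [MonoidHom.mem_ker] at hσ
    rw [hσ, map_one]
  · -- `χbar (Frob_v) = ψ([v])`
    intro v Q hQ φ hφ
    obtain ⟨𝔓v, h𝔓v⟩ := v.primesAbove_nonempty
    obtain ⟨σ, hσ⟩ := HeightOneSpectrum.exists_isArithFrobAt_of_mem_primesAbove_holds h𝔓v
    haveI : 𝔓v.IsPrime := h𝔓v.1
    have hQ₁ := comap_ringOfIntegersToIntegralClosure_mem_primesOver_of_mem_primesAbove E h𝔓v
    have hφ₁ := isArithFrobAt_absRestrictNormalHom E hσ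
    have hφeq : φ = absRestrictNormalHom E σ :=
      eq_of_isArithFrobAt_of_commute (hunrE v) hcommE hQ₁ hQ hφ₁ hφ
    rw [hφeq, hχbar, hcompat, hχ₀]
    -- `χ(σ|_L) = ω'(ϖ_v) = ω(ϖ_v) = ψ([v])`
    have h1 := (hω' v).2 (hρunr v) 𝔓v h𝔓v σ hσ
    rw [heq, (hω v (hnot v)).2] at h1
    rw [FramedRep.det_apply, Matrix.GeneralLinearGroup.val_det_apply, Matrix.det_fin_one, hρdef,
      inflateCharacter_apply_coe] at h1
    exact Units.val_injective h1.symm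

end Literature.NumberTheory.NumberFields
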